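import Mathlib
import Summits.Ventures.HodgeRepro.Tier4.Target
import Summits.Ventures.HodgeRepro.Tier4.Line3.Defs
import Summits.Ventures.HodgeRepro.Tier4.Line3.LocaliserS
import Summits.Ventures.HodgeRepro.Tier4.Line3.ClassBoundGauss
import Summits.Ventures.HodgeRepro.Tier4.Line3.GrowthInvOfGauss

/-!
# Tier4/Line3/SlotGaussOfDecay — the product-form Gaussian bound on the slot coefficients from `ThetaData.decay`

Blind re-derivation cell `pub-hodge-repro`, Tier 4 «PROVE THE STEP» (README §9–§10), LINE L3, seat t4-L2-p1 g2.

The growth interface of the invariant route of L3.5 (plan-3 S13226, after the lead's cut S13215) rests on a DATA clause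
(cf-G) `SlotGauss D : ∃ C c₀, 0 < c₀ ∧ ∀ j x, ‖D.cf j x‖ ≤ C · gaussDefAt c₀ x` — the slot coefficient functions bounded
by the product of the definite Gaussians, with NO polynomial factor at `τ₀`.  The tree's `ThetaData.decay` is stated ONE
definite embedding at a time and WITH the factor `(1 + ‖ballCoord x‖)^e`.  This module closes the first gap: the per-`σ`
bounds multiply to the product form at the constant `c₀ / n`, `n` = the number of definite embeddings (`≥ 2`, since
`[E′ : ℚ] = 2 [E′⁺ : ℚ] ≥ 4`): `exists_slotGauss_poly` — `‖D.cf j x‖ ≤ C (1 + ‖ballCoord x‖)^e gaussDefAt (c₀/n) x`.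
So (cf-G) differs from what every `ThetaData` carries EXACTLY by the exponent `e = 0`; the line table can display the
data clause as «`decay` with `e = 0`».  Nothing here asserts anything about the truth of (P); HC_CM is NOT proved by
anyone in this repository.
-/

set_option autoImplicit false

noncomputable section

namespace Summit.Ventures.HodgeRepro.Tier4.Line3

open Summit.Ventures.HodgeRepro.Tier4
open Matrix NumberField

namespace T4Data

variable (X : T4Data)

/-- `[E′ : ℚ] ≥ 4`: `E′` is a quadratic extension of `E′⁺` and `[E′⁺ : ℚ] ≥ 2` (`T4Data.hE`). -/
theorem four_le_card_embeddings : 4 ≤ Fintype.card (X.E →+* ℂ) := by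
  rw [NumberField.Embeddings.card X.E ℂ, ← Module.finrank_mul_finrank ℚ (maximalRealSubfield X.E) X.E,
    Algebra.IsQuadraticExtension.finrank_eq_two (maximalRealSubfield X.E) X.E]
  have := X.hE
  omega

/-- There is a definite embedding (one different from `τ₀` and its conjugate). -/
theorem exists_definite_embedding : ∃ σ : X.E →+* ℂ, σ ≠ X.τ₀ ∧ σ ≠ conjEmb X.τ₀ := by
  classical
  by_contra hcon
  have h : ∀ σ : X.E →+* ℂ, σ ≠ X.τ₀ → σ = conjEmb X.τ₀ := fun σ hσ => by
    by_contra h'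
    exact hcon ⟨σ, hσ, h'⟩
  have hsub : (Finset.univ : Finset (X.E →+* ℂ)) ⊆ {X.τ₀, conjEmb X.τ₀} := by
    intro σ _
    by_cases hσ : σ = X.τ₀
    · simp [hσ]
    · simp [h σ hσ]
  have h1 := Finset.card_le_card hsub
  have h2 : ({X.τ₀, conjEmb X.τ₀} : Finset (X.E →+* ℂ)).card ≤ 2 := Finset.card_le_two
  have h4 := X.four_le_card_embeddings
  rw [← Finset.card_univ] at h4
  omega

open scoped Classical in
/-- The number of definite embeddings is positive. -/
theorem card_definite_pos :
    0 < (Finset.univ.filter (fun σ : X.E →+* ℂ => σ ≠ X.τ₀ ∧ σ ≠ conjEmb X.τ₀)).card := by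
  obtain ⟨σ, hσ⟩ := X.exists_definite_embedding
  exact Finset.card_pos.mpr ⟨σ, by simp [hσ]⟩

/-- `gaussDefAt (c₀ / n) x ^ n = gaussDefAt c₀ x` for `n ≠ 0`. -/
theorem gaussDefAt_div_pow (c₀ : ℝ) (x : Fin 3 → X.E) {n : ℕ} (hn : n ≠ 0) :
    X.gaussDefAt (c₀ / n) x ^ n = X.gaussDefAt c₀ x := by
  classical
  rw [X.gaussDefAt_eq_prod, X.gaussDefAt_eq_prod, ← Finset.prod_pow]
  refine Finset.prod_congr rfl fun σ _ => ?_
  rw [← Real.exp_nat_mul]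
  congr 1
  have hn' : (n : ℝ) ≠ 0 := Nat.cast_ne_zero.mpr hn
  field_simp

/-- **THE PRODUCT-FORM GAUSSIAN BOUND FROM `ThetaData.decay`**: `‖D.cf j x‖ ≤ C (1 + ‖ballCoord x‖)^e gaussDefAt c₀' x`
for every slot `j` and vector `x`, with `C ≥ 0`, `c₀' > 0` — the per-embedding bounds of `decay` multiplied over the `n`
definite embeddings and the `n`-th root taken (`c₀' = c₀ / n`).  (cf-G) is this statement with `e = 0`. -/
theorem exists_slotGauss_poly (D : X.ThetaData) :
    ∃ C e c₀ : ℝ, 0 ≤ C ∧ 0 < c₀ ∧ ∀ (j : Fin 4) (x : Fin 3 → X.E),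
      ‖D.cf j x‖ ≤ C * (1 + ‖X.ballCoord x‖) ^ e * X.gaussDefAt c₀ x := by
  classical
  obtain ⟨C, e, c₀, hc₀, hdec⟩ := D.decay
  set S : Finset (X.E →+* ℂ) := Finset.univ.filter (fun σ : X.E →+* ℂ => σ ≠ X.τ₀ ∧ σ ≠ conjEmb X.τ₀) with hS
  have hn : S.card ≠ 0 := (X.card_definite_pos).ne'
  refine ⟨max C 0, e, c₀ / S.card, le_max_right _ _, by positivity, fun j x => ?_⟩
  have hpoly : 0 ≤ (1 + ‖X.ballCoord x‖) ^ e := Real.rpow_nonneg (by positivity) e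
  -- the `n`-th power of the bound: the per-embedding bounds multiplied over the definite embeddings
  have hpow : ‖D.cf j x‖ ^ S.card ≤
      (max C 0 * (1 + ‖X.ballCoord x‖) ^ e) ^ S.card * X.gaussDefAt c₀ x := by
    rw [X.gaussDefAt_eq_prod, ← hS, ← Finset.prod_const, ← Finset.prod_const, ← Finset.prod_mul_distrib]
    refine Finset.prod_le_prod (fun σ _ => norm_nonneg _) fun σ hσ => ?_
    rw [hS, Finset.mem_filter] at hσ
    calc ‖D.cf j x‖ ≤ C * (1 + ‖X.ballCoord x‖) ^ e * Real.exp (-(c₀ * ∑ i, ‖σ (x i)‖ ^ 2)) :=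
          hdec j x σ hσ.2.1 hσ.2.2
      _ ≤ max C 0 * (1 + ‖X.ballCoord x‖) ^ e * Real.exp (-(c₀ * ∑ i, ‖σ (x i)‖ ^ 2)) := by
          gcongr
          exact le_max_left _ _
  have hpow' : ‖D.cf j x‖ ^ S.card ≤
      (max C 0 * (1 + ‖X.ballCoord x‖) ^ e * X.gaussDefAt (c₀ / S.card) x) ^ S.card := by
    rw [mul_pow, X.gaussDefAt_div_pow c₀ x hn]
    exact hpow
  exact (pow_le_pow_iff_left₀ (norm_nonneg _)
    (mul_nonneg (mul_nonneg (le_max_right _ _) hpoly) (X.gaussDefAt_nonneg _ _)) hn).mp hpow'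

end T4Data

end Summit.Ventures.HodgeRepro.Tier4.Line3

end
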